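import Summits.BirchSwinnertonDyer.Rank1Residual.Ordinary.Conjectures.KolyvaginKimDatumOfEulerSystemReduction
import HarnessLib

/-!
# The typed input `KolyvaginKimDatum` from an Euler system of `T_3E` ON C-16's LETTER, THEOREM D's `htors₃` and `rd`/`hrd` DISCHARGED
# (companion of `KolyvaginKimDatumOfEulerSystemReduction.lean` (F34) at the DATUM level; theorems only; nothing asserted;
# C-16 stays a CONJECTURE)

HONEST FRAMING (cell `b2b-bsdres`, run/shared/lean/b2b/bsd-rank1-residual/, verbatim in every
file): the goal of the cell is to DELETE the COMBINATION-SHAPED residual classes of the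
Birch–Swinnerton-Dyer formula for ALL analytic-rank `≤ 1` elliptic curves over `ℚ` — "full BSD
formula for every rank `≤ 1` curve in class `C`" assembled STRICTLY from published theorems — so
that the rank-`≤ 1` remainder becomes exactly the CONSTRUCTION-SHAPED classes, which are TYPED
(missing-input `Prop`s), NOT attempted. This is not "finishing BSD". Seat `b2b-bsdres-additive-p3`
(X8 prover B / X7 joint; typer-designate for the cell conjecture C-16 = hyp C120.1; ladder BSD:K3 hand-off to cell
`bsd-ssimc`; written inside the D-0075 claim window). This file books nothing and moves no mark; X7 / X8 stay
CONSTRUCTION-SHAPED; C-16 = CONJECTURE. NO Euler system is asserted to exist (binder `hc`).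

## What this file does

F31 §1 `kolyvaginKimDatum_of_isEulerSystem_torsionCoeff` produces C-16's ONE typed residual input
`KolyvaginKimDatum W f 3 ℓ k₀ (k+1) Q vℓ vp ψ` (F25) from an Euler system `c` of `T_3E` over the cyclotomic levels with n1011's
THEOREM D binders displayed, among them three CURVE-LEVEL certificates: `hbad` (`E(ℚ_w)[3] = 0` at the bad `w ≠ 3`), `htors₃`
(`E(ℚ_v)[3] = 0` at `v ∣ 3`) and the reduction tower `rd`/`hrd`. F31b discharged `htors₃` from the letter for the per-letter
clause only; F34 discharged `rd`/`hrd` for the per-letter clauses. This file does both AT THE DATUM LEVEL — the object a K3 typer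
(cell `bsd-ssimc`) consumes through F25's readers:

* `kolyvaginKimDatum_of_isEulerSystem_torsionCoeff_letter_canonicalRed` — the datum from an Euler system of `T_3E` with the
  letter's place-`3` clauses (`3` good, `a₃ ∉ {1, −2}`) in place of `htors₃` (F31b
  `forall_three_nsmul_eq_zero_adicCompletion_of_frobeniusTrace_three`) and the reduction tower supplied by F34
  `exists_torsionReductionTower W 3`; THEOREM D's ONLY remaining curve-level certificate is `hbad` (NOT a clause of C-16's
  letter; rows with an anomalous bad place go through F33's `…_of_primes''` variant, whose datum form has no `rd` binder at all).

Nothing here is new mathematics (F31 §1 applied to F31b's lemma and F34's tower). C-16 stays a CONJECTURE; the displayed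
`hread` is exactly the K3 typer's T2′/T3′ (hand-off index §2), the Euler system `c` its T1′.

References: B. Mazur, K. Rubin, Mem. AMS 799 (2004) Thm. 3.2.4, 5.2.12, App. A [MazurRubin2004]; C.-H. Kim, arXiv:2203.12159
Thm. 3.13, (5.3) [Kim2022StructureSelmer]; R. Sakamoto, JTNB 36 (2024) §2, Def. 4.1 [Sakamoto2024]; J. H. Silverman, AEC (2009)
IV.6.1, VII.2.1 [SilvermanAEC2009].
-/

noncomputable section

open CategoryTheory Function Finset Field IsDedekindDomain
open scoped NumberField Classical ContRepresentation MatrixGroups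
open CongruenceSubgroup WeierstrassCurve Literature.NumberTheory.EllipticCurves
  Literature.NumberTheory.EllipticCurves.ModularForms
  Literature.NumberTheory.EllipticCurves.Rank1Residual
  Literature.NumberTheory.GaloisRepresentations Literature.NumberTheory.GaloisCohomology
  Literature.NumberTheory.GaloisRepresentations.DiscreteGaloisModule
  NumberField
  Summit.BirchSwinnertonDyer.Rank1Residual.GaloisImage
  Summit.BirchSwinnertonDyer.Rank1Residual.GaloisImage.CoeffTransport
  Summit.BirchSwinnertonDyer.Rank1Residual.GaloisImage.CyclotomicLevel
  Summit.BirchSwinnertonDyer.Rank1Residual.GaloisImage.TorsionCoeff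
  Rat.HeightOneSpectrum

namespace Summit.BirchSwinnertonDyer.Rank1Residual.Ordinary

variable (W : WeierstrassCurve ℚ) [W.IsElliptic] [W.IsGloballyMinimal]
variable [Module.Free ℤ_[3] (W.tateModule 3)] [Module.Finite ℤ_[3] (W.tateModule 3)]
  [ContinuousSMul ℤ_[3] (W.tateModule 3)]

/-- Local notation: `T∞ = T_3 E` as a continuous `G_ℚ`-representation (as in n1011's THEOREM D files). -/
local notation3 "T∞" => WeierstrassCurve.tateGaloisRep W 3 (W.continuous_galoisRepTate_holds 3)

variable (S : Set (HeightOneSpectrum (𝓞 ℚ)))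

/-- Local notation: `𝓛` = the cyclotomic Euler-system levels `ℚ(μ_{3^{n+1}}, μ_r)`, `r ∩ S = ∅`. -/
local notation3 "𝓛" => cyclotomicLevelsRat 3 S

/-- Local notation: `𝐃ℤ⟦X, U, τ⟧ ℓ = ∑_{j < ℓ−1} j·(τ_ℓ)_*^j` on `H¹(U, X)` (`ℤ`-linear), Kolyvagin's derivative operator. -/
local notation3 (prettyPrint := false) "𝐃ℤ⟦" X ", " U ", " τ "⟧" =>
  fun ℓ : HeightOneSpectrum (𝓞 ℚ) =>
  ∑ j ∈ Finset.range (((primesEquiv ℓ : Nat.Primes) : ℕ) - 1),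
    (j : Module.End ℤ (continuousCohomology 1 (subgroupRep X U))) *
      (conjMap X U ((τ : HeightOneSpectrum (𝓞 ℚ) → absoluteGaloisGroup ℚ) ℓ) 1).hom.toLinearMap ^ j

/-- Local notation: the level-`j` reduction `red_j : T_3E ⟶ E[3^j]_{ℤ_3}` (n1011 GZ-2). -/
local notation3 "𝐫𝐞𝐝⟦" j "⟧" => tateModuleRed W 3 (W.continuous_galoisRepTate_holds 3) j

/-! ### §1 The datum on C-16's letter from an Euler system of `T_3E`: `htors₃` and the reduction tower discharged -/

section Datum

variable {N : ℕ} (f : CuspForm (Gamma0 N) 2) (ℓ k₀ k : ℕ) [Fact ℓ.Prime] (Q : W.toAffine.Point)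
  (vℓ vp : HeightOneSpectrum (𝓞 ℚ)) (ψ : (q : ℕ) → (ZMod q)ˣ →* Multiplicative (ZMod (3 ^ k₀)))

/-- **`KolyvaginKimDatum` at depth `k + 1` (prime `3`) from an EULER SYSTEM of `T_3E` ON C-16's LETTER — F31 §1
`kolyvaginKimDatum_of_isEulerSystem_torsionCoeff` with THEOREM D's place-`3` certificate `htors₃` DISCHARGED from the letter
(`3` good, `a₃ ∉ {1, −2}`; F31b `forall_three_nsmul_eq_zero_adicCompletion_of_frobeniusTrace_three`) and its reduction tower
`rd`/`hrd` DISCHARGED for every curve (F34 `exists_torsionReductionTower W 3`).** Binders left: the Euler system `c` (`hc`; Kato's —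
NOT asserted), `Irr(E[3])`, THE CANONICAL Kolyvagin datum (`D`, `hT`, `hD`, `hPr`, `hKol`), THEOREM D's ONLY remaining curve-level
certificate `hbad` (`E(ℚ_w)[3] = 0` at the bad `w ≠ 3` — NOT a clause of C-16's letter), F30's binders (Sakamoto's `(Sτ, τ)`,
`vℓ ∈ 𝒫` good with `vℓ ∤ 3`, `vp ∋ 3`, the divisibility witness) and the ONE reading hypothesis `hread` on every derived system
(bottom class `κ(Q)`; Kim's reading at `vp`, OPEN at `3`). Nothing asserted; C-16 stays a CONJECTURE.
[cite: MazurRubin2004, Thm. 3.2.4, Thm. 5.2.12 and App. A] [cite: Kim2022StructureSelmer, Thm. 3.13 and (5.3)]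
[cite: Sakamoto2024, §2 (p. 921) and Def. 4.1 (p. 926)] [cite: SilvermanAEC2009, IV.6.1 and Prop. VII.2.1] -/
theorem kolyvaginKimDatum_of_isEulerSystem_torsionCoeff_letter_canonicalRed
    -- C-16's letter at the place `3`: `3` good, `a₃ ∉ {1, −2}` (⟹ `E(ℚ_v)[3] = 0` at `v ∣ 3`, F31b)
    (hgood₃ : W.HasGoodReductionAtPrime 3) (ha1 : W.frobeniusTrace 3 ≠ 1) (ha2 : W.frobeniusTrace 3 ≠ -2)
    -- the Euler system and THEOREM D's binders
    {c : ∀ (i : ℕ) (r : (𝓛).Ideals), H1 T∞ ((𝓛).level i r.1)}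
    (hc : IsEulerSystem 𝓛 T∞ 3 c) (hirr : W.HasIrreducibleModPGaloisRep 3)
    (D : KolyvaginDatum (W.torsionGaloisModule (((3 : ℕ) : ℤ) ^ k * ((3 : ℕ) : ℤ))))
    (hT : D.transverse = cyclotomicTransverse (W.torsionGaloisModule (((3 : ℕ) : ℤ) ^ k * ((3 : ℕ) : ℤ))))
    {η : (q : HeightOneSpectrum (𝓞 ℚ)) → (ZMod (Ideal.absNorm q.asIdeal))ˣ}
    (hD : D.HasCanonicalComparison (3 ^ (k + 1)) η)
    (hPr : D.primes ⊆ (𝓛).primes)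
    (hKol : ∀ q ∈ D.primes, Kato.IsKolyvaginPrime W 3 (k + 1) ((primesEquiv q : Nat.Primes) : ℕ))
    -- THEOREM D's ONLY remaining curve-level certificate (NOT a clause of C-16's letter)
    (hbad : ∀ w : HeightOneSpectrum (𝓞 ℚ), ¬ W.HasGoodReductionAt w →
      ((primesEquiv w : Nat.Primes) : ℕ) ≠ 3 →
        ∀ P : (W.baseChange (w.adicCompletion ℚ)).toAffine.Point, 3 • P = 0 → P = 0)
    -- F30's binders: Sakamoto's `τ`-class for the canonical datum, the place `vℓ`, the divisibility witness
    (Sτ : Set (HeightOneSpectrum (𝓞 ℚ))) {τ : absoluteGaloisGroup ℚ}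
    (hτq : Nonempty (cokerSubOne (W.torsionGaloisModule (((3 : ℕ) : ℤ) ^ k * ((3 : ℕ) : ℤ))) τ ≃+ ZMod (3 ^ (k + 1))))
    (hτμ : τ ∈ rootsOfUnityFixer ℚ (3 ^ (k + 1)))
    (hP : D.primes ⊆ frobeniusClassPrimes (W.torsionGaloisModule (((3 : ℕ) : ℤ) ^ k * ((3 : ℕ) : ℤ))) Sτ τ (3 ^ (k + 1)))
    (hDℓ : vℓ ∈ D.primes)
    (hdiv : ∀ X : geomPoints W, ∃ R : geomPoints W, (((3 : ℕ) : ℤ) ^ k * ((3 : ℕ) : ℤ)) • R = X)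
    (hpv : ((3 : ℕ) : 𝓞 ℚ) ∉ vℓ.asIdeal) (hgood : W.HasGoodReductionAt vℓ) (hvp : ((3 : ℕ) : 𝓞 ℚ) ∈ vp.asIdeal)
    -- the two READINGS of the derived system: bottom class (MR Thm. 5.2.12) and Kim's reading (Thm. 3.13 + (5.3))
    (hread : letI := TorsionCoeff.torsionBy.padicIntModule 3 (k + 1) (WeierstrassCurve.geomPoints W)
      ∀ (σ : HeightOneSpectrum (𝓞 ℚ) → absoluteGaloisGroup ℚ)
        (Φ : ∀ r : Finset (HeightOneSpectrum (𝓞 ℚ)),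
          continuousCohomology 1 (subgroupRep (torsionRepPadicInt W 3 (k + 1)).toTopRep ((𝓛).level ⊥ r)) →+
            continuousCohomology 1 (subgroupRep
              (W.torsionGaloisModule (((3 : ℕ) : ℤ) ^ k * ((3 : ℕ) : ℤ))).toTopRep ((𝓛).level ⊥ r)))
        (comm : ∀ r : Finset (HeightOneSpectrum (𝓞 ℚ)),
          ((r : Finset _) : Set (HeightOneSpectrum (𝓞 ℚ))).Pairwise fun a b =>
            Commute (𝐃ℤ⟦(W.torsionGaloisModule (((3 : ℕ) : ℤ) ^ k * ((3 : ℕ) : ℤ))).toTopRep, ((𝓛).level ⊥ r), σ⟧ a)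
              (𝐃ℤ⟦(W.torsionGaloisModule (((3 : ℕ) : ℤ) ^ k * ((3 : ℕ) : ℤ))).toTopRep, ((𝓛).level ⊥ r), σ⟧ b))
        (κ : Finset (HeightOneSpectrum (𝓞 ℚ)) →
          galoisCohomology (W.torsionGaloisModule (((3 : ℕ) : ℤ) ^ k * ((3 : ℕ) : ℤ))) 1),
        (∀ q, σ q ∈ (adicCompletionPrime ℚ q).inertia (absoluteGaloisGroup ℚ)) →
        (∀ q, modNCyclotomicCharacter ℚ (Ideal.absNorm q.asIdeal) (σ q) = η q) →
        (∀ r, ∀ (φ : contOneCocycles (subgroupRep (torsionRepPadicInt W 3 (k + 1)).toTopRep ((𝓛).level ⊥ r)))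
          (ψ' : contOneCocycles (subgroupRep
            (W.torsionGaloisModule (((3 : ℕ) : ℤ) ^ k * ((3 : ℕ) : ℤ))).toTopRep ((𝓛).level ⊥ r))),
          (∀ g, ψ'.1 g = AddSubgroup.inclusion (geomTorsion_pow_succ_eq W 3 k).le (φ.1 g)) →
            Φ r (oneCocycleClass _ φ) = oneCocycleClass _ ψ') →
        D.IsKolyvaginSystem (propagatedSelmerStructure W 3 k) κ →
        (∀ r : Finset (HeightOneSpectrum (𝓞 ℚ)), ¬ (↑r : Set _) ⊆ D.primes → κ r = 0) →
        (∀ (r : Finset (HeightOneSpectrum (𝓞 ℚ))) (hr : (↑r : Set _) ⊆ D.primes),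
          resSubgroup (W.torsionGaloisModule (((3 : ℕ) : ℤ) ^ k * ((3 : ℕ) : ℤ))).toTopRep ((𝓛).level ⊥ r) 1
              (κ r) =
            (r.noncommProd 𝐃ℤ⟦(W.torsionGaloisModule (((3 : ℕ) : ℤ) ^ k * ((3 : ℕ) : ℤ))).toTopRep,
                ((𝓛).level ⊥ r), σ⟧ (comm r))
              (Φ r (ContinuousCohomology.map (ContinuousMonoidHom.id _)
                (X := subgroupRep T∞.toTopRep ((𝓛).level ⊥ r))
                (Y := subgroupRep (torsionRepPadicInt W 3 (k + 1)).toTopRep ((𝓛).level ⊥ r))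
                ((TopRep.resFunctor ((𝓛).level ⊥ r).subtype).map 𝐫𝐞𝐝⟦k + 1⟧) 1
                (c ⊥ ⟨r, fun _ hq => hPr (hr (Finset.mem_coe.2 hq))⟩)))) →
        κ ∅ = kummerMapTorsion W (((3 : ℕ) : ℤ) ^ k * ((3 : ℕ) : ℤ)) hdiv Q ∧
        ∀ ψp : galoisCohomology ((W.torsionGaloisModule (((3 : ℕ) : ℤ) ^ k * ((3 : ℕ) : ℤ))).toLocal (Sum.inr vp)) 1 ⧸
            W.kummerSelmerStructure (((3 : ℕ) : ℤ) ^ k * ((3 : ℕ) : ℤ)) (Sum.inr vp) ≃+ ZMod (3 ^ (k + 1)),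
          (haveI : NeZero ℓ := ⟨(Fact.out : ℓ.Prime).ne_zero⟩
           zmodPowOrd 3 k₀ (kuriharaNumber f (3 ^ k₀) ℓ ψ)) =
            min k₀ (zmodPowOrd 3 (k + 1)
              (ψp (galoisCohomology.localization (W.torsionGaloisModule (((3 : ℕ) : ℤ) ^ k * ((3 : ℕ) : ℤ)))
                (Sum.inr vp) 1 (κ {vℓ}))))) :
    KolyvaginKimDatum W f 3 ℓ k₀ (k + 1) Q vℓ vp ψ := by
  obtain ⟨rd, hrd⟩ := exists_torsionReductionTower W 3
  exact kolyvaginKimDatum_of_isEulerSystem_torsionCoeff W S f ℓ k₀ k Q vℓ vp ψ hc hirr D hT hD hPr hKol hbad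
    (forall_three_nsmul_eq_zero_adicCompletion_of_frobeniusTrace_three W hgood₃ ha1 ha2) rd hrd Sτ hτq hτμ hP hDℓ hdiv
    hpv hgood hvp hread

end Datum

end Summit.BirchSwinnertonDyer.Rank1Residual.Ordinary

end
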